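import Mathlib
import HarnessLib
import Summits.NavierStokesRegularity.NavierStokesRegularity.Theorems.PoloidalWindowDoorPoloidalWindowRigidityRieszCollapse

/-!
# Route `PoloidalWindowDoor`, crux `PoloidalWindowRigidity` (stmt-19708): the REGISTERED stub `stub_semiEllipticThick` (cell `hST` of
# `…ThmAThreeStubs.twisting_regular_of_three`, skeleton z_shock v3; shared by mixed_type / far_thread / thread_axis / strain_tube / sonic_cut)
# is a THEOREM — semi-elliptic slabs do not twist (from R1 `…RieszCollapse.stub_rieszCollapse`, p650966)

Seat ns-poloidal-K2-p2 g10 (LEAD-lineage on 19708).  Statement VERBATIM = the registered signature of `stub_semiEllipticThick` on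
stmt-NavierStokesRegularity-19708 (= `Lines/sonic_cut.lean` `semiEllipticThick_of_rieszCollapse`, string-checked equal).  Proof (ns-idea-8's
composition step 1, now unconditional): pick a point `z` of the non-empty window `W`; its slice `z.1 ∈ (a,b)` is semi-elliptic (`I ≥ 0` everywhere),
so by R1 `∂₂v₂(z.1, ·) ≡ 0`; then `x ↦ ∂₂v₂(z.1,x)` is the zero function, its derivative vanishes, and the twist clause
`∂₀(∂₂v₂)·∂₁v₂ − ∂₁(∂₂v₂)·∂₀v₂ ≠ 0` at `z` is violated.  (M) is consumed inside R1 through S1.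

WHAT THIS IS NOT: not a proof of the crux (cells `hH` = `stub_hyperbolicTH` and the hyperbolic-thick cells remain); no statement about
Navier–Stokes regularity. [folklore]
-/

noncomputable section

-- the summit and its single sub-problem share the name (CONVENTIONS §1), as in every Theorems file
set_option linter.dupNamespace false

namespace Summit.NavierStokesRegularity.NavierStokesRegularity.Theorems.PoloidalWindowDoorPoloidalWindowRigiditySemiEllipticThick

open MeasureTheory Set Function Filter Topology Metric
open scoped RealInnerProductSpace InnerProductSpace
open Literature.Analysis Literature.Analysis.FluidPDE
open Summit.NavierStokesRegularity.NavierStokesRegularity.Theorems.PoloidalWindowDoorPoloidalWindowRigidityRieszCollapse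

/-- **STUB `stub_semiEllipticThick` (registered on stmt-19708, skeleton z_shock v3; cell `hST`) — PROVED**: a non-degenerate twisting window of
a class profile, poloidal along `e₃`, whose time-slab `(a,b)` is SEMI-ELLIPTIC (`∂₂v₀∂₀v₂ + ∂₂v₁∂₁v₂ ≥ 0` on every slice of the slab) cannot
exist — hence (vacuously) the profile is not backward-singular: by R1 every slice of the slab has `∂₂v₂ ≡ 0`, contradicting the twist clause at
any point of the window. [folklore] -/
theorem stub_semiEllipticThick :
    ∀ (C : ℝ) (v : ℝ →
      EuclideanSpace ℝ (Fin 3) →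
      EuclideanSpace ℝ (Fin 3)), Literature.Analysis.FluidPDE.HasTypeITimeDecay C v →
      ContinuousOn (Function.uncurry v) (Set.Iio (0 : ℝ) ×ˢ Set.univ) →
      (∀ s t : ℝ, s < t →
      t < 0 →
      ∀ x, v t x = Literature.Analysis.UnboundedOperators.heatExtension (v s) (t - s) x - Literature.Analysis.FluidPDE.oseenDuhamel 1 s v v t x) →
      (∀ t < 0, Literature.Analysis.FluidPDE.VectorCalculus.IsDivFree (v t)) →
      (∀ s < 0, ∀ y, ⟪Literature.Analysis.FluidPDE.curl (v s) y, EuclideanSpace.single 2 1⟫_ℝ = 0) →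
      ∀ W : Set (ℝ × EuclideanSpace ℝ (Fin 3)), IsOpen W →
      W.Nonempty →
      W ⊆ Set.Iio (0 : ℝ) ×ˢ Set.univ →
      (∀ z ∈ W, Literature.Analysis.FluidPDE.curl (v z.1) z.2 ≠ 0 ∧ (fderiv ℝ (v z.1) z.2 (EuclideanSpace.single 0 1) 2 ≠ 0 ∨ fderiv ℝ (v z.1) z.2 (EuclideanSpace.single 1 1) 2 ≠ 0) ∧ (fderiv ℝ (v z.1) z.2 (EuclideanSpace.single 2 1) 0 ≠ 0 ∨ fderiv ℝ (v z.1) z.2 (EuclideanSpace.single 2 1) 1 ≠ 0)) →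
      (∀ m : ℝ →
      ℝ, ∀ W₁ : Set (ℝ × EuclideanSpace ℝ (Fin 3)), W₁ ⊆ W →
      IsOpen W₁ →
      W₁.Nonempty →
      ∃ z ∈ W₁, ∃ b : Fin 3, b ≠ 2 ∧ fderiv ℝ (v z.1) z.2 (EuclideanSpace.single 2 1) b ≠ m z.1 * fderiv ℝ (v z.1) z.2 (EuclideanSpace.single b 1) 2) →
      (∀ z ∈ W, fderiv ℝ (fun x => fderiv ℝ (v z.1) x (EuclideanSpace.single 2 1) 2) z.2 (EuclideanSpace.single 0 1) * fderiv ℝ (v z.1) z.2 (EuclideanSpace.single 1 1) 2 - fderiv ℝ (fun x => fderiv ℝ (v z.1) x (EuclideanSpace.single 2 1) 2) z.2 (EuclideanSpace.single 1 1) * fderiv ℝ (v z.1) z.2 (EuclideanSpace.single 0 1) 2 ≠ 0) →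
      ∀ a b : ℝ, W ⊆ Set.Ioo a b ×ˢ Set.univ →
      (∀ s ∈ Set.Ioo a b, ∀ y : EuclideanSpace ℝ (Fin 3), 0 ≤ fderiv ℝ (v s) y (EuclideanSpace.single 2 1) 0 * fderiv ℝ (v s) y (EuclideanSpace.single 0 1) 2 + fderiv ℝ (v s) y (EuclideanSpace.single 2 1) 1 * fderiv ℝ (v s) y (EuclideanSpace.single 1 1) 2) →
      (∀ m : ℝ →
      ℝ →
      ℝ, ∀ W₁ : Set (ℝ × EuclideanSpace ℝ (Fin 3)), W₁ ⊆ W →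
      IsOpen W₁ →
      W₁.Nonempty →
      ∃ z ∈ W₁, ∃ b : Fin 3, b ≠ 2 ∧ fderiv ℝ (v z.1) z.2 (EuclideanSpace.single 2 1) b ≠ m z.1 (z.2 2) * fderiv ℝ (v z.1) z.2 (EuclideanSpace.single b 1) 2) →
      ¬ Literature.Analysis.FluidPDE.IsBackwardSingularPoint v 0 := by
  intro C v hrate hcont hmild hdiv hpol W _hW hWne hWs _hnd _hpin htw a b hWab hsemi _hth
  obtain ⟨z, hz⟩ := hWne
  have hz1 : z.1 ∈ Set.Ioo a b := (Set.mem_prod.1 (hWab hz)).1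
  have hs0 : z.1 < 0 := by
    have h := (Set.mem_prod.1 (hWs hz)).1
    simpa using h
  have hsemiz : ∀ y : EuclideanSpace ℝ (Fin 3),
      0 ≤ fderiv ℝ (v z.1) y (EuclideanSpace.single 2 1) 0 * fderiv ℝ (v z.1) y (EuclideanSpace.single 0 1) 2 +
          fderiv ℝ (v z.1) y (EuclideanSpace.single 2 1) 1 * fderiv ℝ (v z.1) y (EuclideanSpace.single 1 1) 2 :=
    fun y => hsemi z.1 hz1 y
  have hR := stub_rieszCollapse C v hrate hcont hmild hdiv hpol z.1 hs0 hsemiz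
  have hwz : (fun x => fderiv ℝ (v z.1) x (EuclideanSpace.single 2 1) 2) = fun _ => (0 : ℝ) :=
    funext fun x => (hR x).2.1
  have hzero : fderiv ℝ (fun x => fderiv ℝ (v z.1) x (EuclideanSpace.single 2 1) 2) z.2 (EuclideanSpace.single 0 1) *
        fderiv ℝ (v z.1) z.2 (EuclideanSpace.single 1 1) 2 -
      fderiv ℝ (fun x => fderiv ℝ (v z.1) x (EuclideanSpace.single 2 1) 2) z.2 (EuclideanSpace.single 1 1) *
        fderiv ℝ (v z.1) z.2 (EuclideanSpace.single 0 1) 2 = 0 := by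
    rw [hwz]
    simp
  exact absurd hzero (htw z hz)

end Summit.NavierStokesRegularity.NavierStokesRegularity.Theorems.PoloidalWindowDoorPoloidalWindowRigiditySemiEllipticThick

end
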